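import Summits.QuantumFields.YangMills.Theorems.BalabanUVNodesN21LowCentreEndAtSUNBlockChartPackageCoerciveFlat
import Summits.QuantumFields.YangMills.Theorems.BalabanUVNodesN21LowCentreEndAtSUNBlockChartPackageCoerciveTorusComb
import Summits.QuantumFields.YangMills.Theorems.BalabanUVNodesN21LowCentreEndAtSUNBlockChartJacobianWitness

/-!
# N21 (NE7c) · A6 WITNESS OF THE FLAT-BACKGROUND (M1) PACKAGE (file 35): at ONE bond off the axial comb of the `2 × 2` box of a
# `d = 2` torus, group `SU(2)`, NODE O's flat Hessian of record `hessOpAt 1 1`, window `S = ½`, the norm statistic and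
# `(θ, ρ) = (10⁸, 1∕100)`, EVERY displayed binder of ★ `cutChartLawAC_of_sect1Letters_analyticLocal_flat` is discharged in the kernel

Width seat pub-ymgap-dag-n21-w1 (g5; director-ym №197 ∕ HUMAN RULING D-0149), node N21 = NE7c (NOT PRINTED in [Bałaban 1983–89], NOT proved), lane K3⁸
`SpineGivenEndpointR13SepCoPHV` (stmt-QuantumFields-27366, KEY MAP v2; lineage K3⁷ 20544), `--kind proof --supports … --as helper`.  File 36 of the seat's chain —
the JOINT satisfiability witness (director-ym STANDING A6 RULE №189 (3)) that files 34∕35 promised in their headers: the torus ∕ box ∕ comb letters of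
dag-n21-w3 g6's road AND file 20's [LF-II]-§1 ∕ statistic ∕ envelope ∕ odds binders and clauses, at the SAME concrete data, with the quadratic member PINNED to
NODE O's `N·⟪X_v, hessOpAt η 1 X_v⟫`.  THEOREMS ONLY: 0 `def`, 0 `sorry`; count-neutral.  Imports files 34∕35 (`…PackageCoerciveTorusComb` ∕ `…PackageCoerciveFlat`) and file 13
(`…JacobianWitness`: `neg_log_sinc_half_le`).  NO Theses import.  Restates nothing.

THE DATA.  `P = ⟨d := 2, L := 3, m := 1, K := 0⟩` (so `T^{(0)}` has `2·3 = 6` sites per direction), `j = 0`; the box `[lo, hi] = [0, 1]²` (sides `2 ≤ 100·M`,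
`M = 1`; non-wrapping: `1 < 6`); the block `b = {⟨castSite (1,0), 1⟩}` — the vertical bond at `(1,0)`, a box bond OFF the axial comb rooted at `lo = 0` (the comb
holds both horizontal bonds and the vertical bond at `(0,0)`; `lowPart 1 ((1,0) − 0) = (1,0)|_{<1} ≠ 0`); `N = 2`, `η = 1`, `S = ½`, `K₀ = ball 0 1`, the EXPONENT
`A v := ½·(2·⟪X_v, hessOpAt 1 1 X_v⟫)` (so the (1.2) identity `hexp` holds with `lin = Vt = 0`), `ℓ = 0`, `Φ = 0` (`r = 3`, `S₂ = 0`), `(B₃, M₀, A₀, p₀, R_k) =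
(10⁻⁸, 1, 1, 1, 0)`, `W_V = 0`; the statistic `U = ‖·‖` (`L = 1`, `σ = 0`), `C = univ`, `Env = {‖z‖ < θ}`, `Q = 0`, `κ₀ = 1`, `θ = 10⁸`, `ρ = 1∕100`.  The numeral's
clause then reads `16·(3·10⁻⁸·10⁸ + 4·(−2 log sinc ½))·2·10⁶·3 ≤ (0.99·10⁸)²` (`−log sinc ½ ≤ 1∕23`, file 13).

WHAT IS PROVED.  `castSite_add_e_mem_boxBonds` ∕ `castSite_add_e_not_mem_combBonds` (the block's two torus letters, for any box with `lo + e_κ + e_μ ≤ hi`, `κ < μ`,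
non-wrapping) · `continuous_flatQf` (the flat quadratic member is continuous — by file 35 §0 a polynomial in the flat coordinates) · ★ `cutChartLaw_flat_torus_binders_inhabited` (the JOINT A6
witness: `∃ P j b, b.card = 1 ∧ (M1)₁ ∧ (M1)₂` — the cut chart law of the flat exponent, norm statistic, `ρ = 1∕100`, at `θ = 10⁸` by APPLYING file 35's ★ and at
`θ = 10⁹` by APPLYING file 34's ★ (`Qf :=` the flat member, `Mq ∕ hQf` from file 35 §0, the (1.7) row in torus letters over `S_p = univ` by dag-n21-w3 g6's
`ineq17_flat_liftSU`, `γ₀ = 1`, `Cc = 0`) — every binder of both discharged in the kernel).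

HONEST FRAMING.  A satisfiability witness of a binder list at toy data, not an estimate on Bałaban's measure: it certifies that file 35's displayed hypotheses
are jointly consistent (no vacuous knit), nothing more; the reading of the (1.2) quadratic member as `N·⟪X_v, Δ_1 X_v⟫` at `U₀ = 1` remains LOCATED typing;
nothing of Bałaban's asserted; (M1) ∕ NE7c NOT PRINTED ∕ NOT proved; **N21 NOT discharged**; K3⁸ NOT claimed; counts unmoved (typed 28∕28 · discharged 5∕27);
never a count claim; one finite 𝕋⁴ at fixed ε — R4 would close only the conditional finite-𝕋⁴ rung `BalabanLadder.UV`, NOT the Yang–Mills mass gap (Clay);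
nothing about ℝ⁴ ∕ OS.  No decl below carries a cite tag.
-/

set_option autoImplicit false

noncomputable section

open MeasureTheory Set Function Finset Metric
open scoped ENNReal BigOperators Matrix InnerProductSpace RealInnerProductSpace

namespace Summit.QuantumFields.YangMills.Theorems.N21LowCentreEndAtSUNBlockChartPackageCoerciveFlatWitness

open Literature.MathematicalPhysics.QuantumFieldTheory.Balaban1983to89
open Literature.MathematicalPhysics.QuantumFieldTheory.Balaban1983to89.T4Continuum
open Literature.MathematicalPhysics.QuantumFieldTheory.Balaban1983to89.Node00 hiding dimSU
open Literature.MathematicalPhysics.QuantumFieldTheory.Balaban1983to89.T4ShellMeasure (SlotAntiConcentration)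
open Literature.MathematicalPhysics.QuantumFieldTheory.Balaban1983to89.B16Sect1Wilson (Ineq16)
open Literature.MathematicalPhysics.QuantumFieldTheory.Balaban1983to89.B7Prop1Explicit (e e_apply)
open Literature.MathematicalPhysics.QuantumFieldTheory.Balaban1983to89.B8Lemma1NonAbelian (lowPart lowPart_apply)
open Literature.MathematicalPhysics.QuantumFieldTheory.Balaban1983to89.T4AxialGaugeSmallField (castSite castSite_injOn_box boxBonds)
open Literature.MathematicalPhysics.QuantumFieldTheory.Balaban1983to89.T4AxialGaugeFixing (combSet combBonds mem_combBonds)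
open T4AdjointCovarianceUnitary (lieSU)
open Summit.QuantumFields.BalabanUV.T4Continuum
open Summit.QuantumFields.BalabanUV.T4Continuum.ShellMeasureExpChartSUN (ChartSU BlockChartSU dimSU dimSU_eq coordSU chartWeightSU)
open Summit.QuantumFields.BalabanUV.T4Continuum.ShellMeasureExpJacobianSUN (expJacWeightSU)
open Summit.QuantumFields.BalabanUV.T4Continuum.ShellMeasureExpHaarAreaSUN (kappaSU)
open Summit.QuantumFields.BalabanUV.T4Continuum.ShellMeasureExpDuhamelSUN (duhT)
open Summit.QuantumFields.YangMills.Theorems.N21LowCentreEndAtSUNBlockChartJacobianWitness (neg_log_sinc_half_le)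
open Summit.QuantumFields.YangMills.Theorems.N21LowCentreEndAtSUNBlockChartPackageCoerciveFlat
  (exists_matrix_flatQf cutChartLawAC_of_sect1Letters_analyticLocal_flat)
open Summit.QuantumFields.YangMills.Theorems.N21LowCentreEndAtSUNBlockChartPackageCoerciveTorusComb
  (cutChartLawAC_of_sect1Letters_analyticLocal_of_ineq17_torus)
open Summit.QuantumFields.YangMills.Theorems.N21ChartExponentCoercivityFlat (ineq17_flat_liftSU)
open Literature.MathematicalPhysics.QuantumFieldTheory.Balaban1983to89.T4AxialGaugeSmallField (boxPlaqs)

/-! ## §1 The torus letters of the one-bond block off the comb of the `2 × 2` box -/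

section TorusLetters

variable {P : Params} {j : ℕ}

/-- for ANY torus and ANY box `[lo, hi]` with `lo + e_κ + e_μ ≤ hi`, the bond `⟨castSite (lo + e_κ), μ⟩` is a box bond. [folklore] -/
theorem castSite_add_e_mem_boxBonds {lo hi : Fin P.d → ℤ} (κ μ : Fin P.d) (h : lo + e κ + e μ ≤ hi) :
    (⟨castSite (lo + e κ), μ⟩ : PBond P j) ∈ (boxBonds lo hi : Set (PBond P j)) := by
  refine ⟨lo + e κ, fun i => ?_, h, rfl⟩
  have : (0 : ℤ) ≤ e κ i := by rw [e_apply]; split_ifs <;> norm_num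
  simpa using this

/-- … and for `κ < μ` on a NON-WRAPPING box it is OFF the axial comb rooted at `lo`: a comb bond `⟨castSite x, μ⟩` has `x_κ = lo_κ` for every
`κ < μ`, while here `x_κ = lo_κ + 1` (`castSite` is one-to-one on the box). [folklore] -/
theorem castSite_add_e_not_mem_combBonds {lo hi : Fin P.d → ℤ} (hN : ∀ i, hi i - lo i < P.sitesPerDir j) {κ μ : Fin P.d} (hκμ : κ < μ)
    (h : lo + e κ + e μ ≤ hi) :
    (⟨castSite (lo + e κ), μ⟩ : PBond P j) ∉ (combBonds lo hi : Finset (PBond P j)) := by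
  intro hmem
  rw [mem_combBonds] at hmem
  obtain ⟨x, hlox, hxhi, hsrc, hlow⟩ := hmem
  have he0 : ∀ (ν i : Fin P.d), (0 : ℤ) ≤ e ν i := fun ν i => by rw [e_apply]; split_ifs <;> norm_num
  -- both `x` and `lo + e κ` lie in the box, and have the same image: they are equal
  have hx_le : x ≤ hi := fun i => by have := hxhi i; have := he0 μ i; simp only [Pi.add_apply] at *; linarith
  have hy_lo : lo ≤ lo + e κ := fun i => by simpa using he0 κ i
  have hy_hi : lo + e κ ≤ hi := fun i => by have := h i; have := he0 μ i; simp only [Pi.add_apply] at *; linarith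
  have hxy : x = lo + e κ := castSite_injOn_box hN hlox hx_le hy_lo hy_hi (by simpa using hsrc.symm)
  -- but `lowPart μ (x − lo)` vanishes at `κ < μ`, i.e. `e κ κ = 0`
  have h0 := congr_fun hlow κ
  rw [hxy, lowPart_apply, if_pos hκμ] at h0
  simp [e_apply] at h0

end TorusLetters

/-! ## §2 The flat quadratic member is continuous -/

section Continuity

variable {P : Params} {j : ℕ} {N : ℕ} [NeZero N]

/-- `v ↦ N·⟪X_v, hessOpAt η 1 X_v⟫` is CONTINUOUS on the block chart space: by file 35 §0 it is `v ⬝ᵥ (Mq *ᵥ v)` in the flat coordinates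
`q ↦ v q.1 q.2`, each of which is continuous (`η ≠ 0` only fixes NODE O's letter). [folklore] -/
theorem continuous_flatQf (b : Finset (PBond P j)) {η : ℝ} (hη : η ≠ 0) :
    Continuous fun v : BlockChartSU N b => (N : ℝ) * ⟪((WithLp.toLp 2 fun bd' : PBond P j =>
          if h : bd' ∈ b then coordSU (v ⟨bd', h⟩) else (0 : lieSU (Fin N))) : TangentBondSU P j N),
        hessOpAt η (1 : GaugeField P j (SU N)) ((WithLp.toLp 2 fun bd' : PBond P j =>
          if h : bd' ∈ b then coordSU (v ⟨bd', h⟩) else (0 : lieSU (Fin N))) : TangentBondSU P j N)⟫_ℝ := by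
  classical
  -- file 35 §0: the flat quadratic member is `v ⬝ᵥ (Mq *ᵥ v)` in the flat coordinates, a polynomial in continuous coordinates
  obtain ⟨Mq, hMq⟩ := exists_matrix_flatQf (N := N) (P := P) (j := j) b hη
  have hcoord : ∀ q : ↥b × Fin (dimSU N), Continuous fun v : BlockChartSU N b => v q.1 q.2 := fun q =>
    (PiLp.continuous_apply 2 (fun _ : Fin (dimSU N) => ℝ) q.2).comp (continuous_apply q.1)
  have hv' : Continuous fun v : BlockChartSU N b => fun q : ↥b × Fin (dimSU N) => v q.1 q.2 :=
    continuous_pi fun q => hcoord q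
  have h : Continuous fun v : BlockChartSU N b =>
      (fun q : ↥b × Fin (dimSU N) => v q.1 q.2) ⬝ᵥ (Mq *ᵥ fun q : ↥b × Fin (dimSU N) => v q.1 q.2) :=
    hv'.dotProduct (continuous_const.matrix_mulVec hv')
  refine (congrArg Continuous (funext fun v => ?_)).mpr h
  exact hMq v

end Continuity

/-! ## §3 ★ The A6 witness: file 35's ★ APPLIED at concrete data, every binder discharged -/

section Witness

/-- ★ **JOINT A6 WITNESS OF FILE 35's ★ `cutChartLawAC_of_sect1Letters_analyticLocal_flat` AND FILE 34's ★ `…_of_ineq17_torus`** (director-ym STANDING A6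
RULE №189 (3)): on the `d = 2` torus with `6` sites per direction, at the vertical bond `⟨castSite (1,0), 1⟩` OFF the axial comb of the box `[0,1]²` (`M = 1`),
group `SU(2)`, `η = 1`, `S = ½`, `K₀ = ball 0 1`, the exponent `A = ½·(2·⟪X_·, hessOpAt 1 1 X_·⟫)` (`lin = Vt = 0`, `Φ = 0`, `r = 3`), the norm statistic, `ρ = 1∕100`
(`D·ρ < 1`: non-trivial (M1)) and `θ = 10⁸` (route 1: file 35's ★ — `h19` a theorem, matrix letter internal) resp. `θ = 10⁹` (route 2: file 34's ★ with `Qf :=` the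
flat member, `Mq ∕ hQf` from file 35 §0, the (1.7) row IN TORUS LETTERS over `S_p = univ` by dag-n21-w3 g6's `ineq17_flat_liftSU`, `γ₀ = 1`, `Cc = 0`, and the
smallness line by `positivity`): EVERY binder of both ★'s — box ∕ comb letters, the (1.2) identity PINNED to NODE O's flat Hessian, (1.6), the analyticity letter,
the statistic's Lipschitz ∕ centre ∕ envelope ∕ radial-transversality ∕ odds binders and BOTH clauses — is discharged in the kernel.  A satisfiability witness of the
binder lists, not an estimate on Bałaban's measure. [textbook] -/
theorem cutChartLaw_flat_torus_binders_inhabited :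
    ∃ (P : Params) (j : ℕ) (b : Finset (PBond P j)), b.card = 1 ∧
      SlotAntiConcentration
        (((volume : Measure (BlockChartSU 2 b)).withDensity fun z =>
            (ball (0 : BlockChartSU 2 b) 1 ∩ closedBall (0 : BlockChartSU 2 b) (1 / 2)).indicator
              (fun w => ENNReal.ofReal (Real.exp (-(
                1 / 2 * (((2 : ℕ) : ℝ) * ⟪((WithLp.toLp 2 fun bd' : PBond P j =>
                    if h : bd' ∈ b then coordSU (w ⟨bd', h⟩) else (0 : lieSU (Fin 2))) : TangentBondSU P j 2),
                  hessOpAt (1 : ℝ) (1 : GaugeField P j (SU 2)) ((WithLp.toLp 2 fun bd' : PBond P j =>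
                    if h : bd' ∈ b then coordSU (w ⟨bd', h⟩) else (0 : lieSU (Fin 2))) : TangentBondSU P j 2)⟫_ℝ) +
                (∑ i, -Real.log (LinearMap.det (duhT (w i) : ChartSU 2 →ₗ[ℝ] ChartSU 2))) -
                  b.card * Real.log (kappaSU 2).toReal)))) z).restrict
          ({z : BlockChartSU 2 b | ‖z‖ < 100000000} ∩ univ))
        (fun z : BlockChartSU 2 b => ‖z‖) 100000000 (1 / 100) (3 * ((b.card : ℝ) * dimSU 2 + 1) * (1 + 0) / (1 * (1 - 1 / 100))) ∧
      SlotAntiConcentration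
        (((volume : Measure (BlockChartSU 2 b)).withDensity fun z =>
            (ball (0 : BlockChartSU 2 b) 1 ∩ closedBall (0 : BlockChartSU 2 b) (1 / 2)).indicator
              (fun w => ENNReal.ofReal (Real.exp (-(
                1 / 2 * (((2 : ℕ) : ℝ) * ⟪((WithLp.toLp 2 fun bd' : PBond P j =>
                    if h : bd' ∈ b then coordSU (w ⟨bd', h⟩) else (0 : lieSU (Fin 2))) : TangentBondSU P j 2),
                  hessOpAt (1 : ℝ) (1 : GaugeField P j (SU 2)) ((WithLp.toLp 2 fun bd' : PBond P j =>
                    if h : bd' ∈ b then coordSU (w ⟨bd', h⟩) else (0 : lieSU (Fin 2))) : TangentBondSU P j 2)⟫_ℝ) +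
                (∑ i, -Real.log (LinearMap.det (duhT (w i) : ChartSU 2 →ₗ[ℝ] ChartSU 2))) -
                  b.card * Real.log (kappaSU 2).toReal)))) z).restrict
          ({z : BlockChartSU 2 b | ‖z‖ < 1000000000} ∩ univ))
        (fun z : BlockChartSU 2 b => ‖z‖) 1000000000 (1 / 100) (3 * ((b.card : ℝ) * dimSU 2 + 1) * (1 + 0) / (1 * (1 - 1 / 100))) := by
  -- the torus, the box, the bond
  let P : Params := Params.mk 2 3 1 0 (by norm_num) ⟨⟨1, rfl⟩, by norm_num⟩
  have hPd : P.d = 2 := rfl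
  let κ₀' : Fin P.d := ⟨0, by rw [hPd]; norm_num⟩
  let μ₀ : Fin P.d := ⟨1, by rw [hPd]; norm_num⟩
  have hκμ : κ₀' < μ₀ := Fin.mk_lt_mk.mpr Nat.zero_lt_one
  let lo : Fin P.d → ℤ := fun _ => 0
  let hi : Fin P.d → ℤ := fun _ => 1
  have he : ∀ (ν i : Fin P.d), e ν i = if i = ν then (1 : ℤ) else 0 := fun ν i => e_apply ν i
  have hbox_le : lo + e κ₀' + e μ₀ ≤ hi := by
    intro i
    simp only [Pi.add_apply, he, lo, hi]
    have hne : κ₀' ≠ μ₀ := hκμ.ne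
    by_cases h1 : i = κ₀'
    · subst h1; simp [hne]
    · by_cases h2 : i = μ₀
      · subst h2; simp [h1]
      · simp [h1, h2]
  have hwrap : ∀ i, hi i - lo i < P.sitesPerDir 0 := fun i => by
    show (1 : ℤ) - 0 < ((2 * 3 ^ (1 + 0 - 0) : ℕ) : ℤ)
    norm_num
  have hsides : ∀ i, hi i + 1 - lo i ≤ 100 * (1 : ℕ) := fun i => by
    show (1 : ℤ) + 1 - 0 ≤ 100 * ((1 : ℕ) : ℤ)
    norm_num
  set b : Finset (PBond P 0) := {⟨castSite (lo + e κ₀'), μ₀⟩} with hb_def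
  have hb : b.Nonempty := Finset.singleton_nonempty _
  have hb1 : b.card = 1 := Finset.card_singleton _
  have hd2 : (dimSU 2 : ℝ) = 3 := by rw [dimSU_eq]; norm_num
  have hbox : ∀ i ∈ b, i ∈ (boxBonds lo hi : Set (PBond P 0)) := fun i hi' => by
    rw [hb_def, Finset.mem_singleton] at hi'
    rw [hi']
    exact castSite_add_e_mem_boxBonds κ₀' μ₀ hbox_le
  have hcomb : ∀ i ∈ b, i ∉ (combBonds lo hi : Finset (PBond P 0)) := fun i hi' => by
    rw [hb_def, Finset.mem_singleton] at hi'
    rw [hi']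
    exact castSite_add_e_not_mem_combBonds hwrap hκμ hbox_le
  -- the flat quadratic member and the exponent `A = ½·Qf`
  set Qf : BlockChartSU 2 b → ℝ := fun w => ((2 : ℕ) : ℝ) * ⟪((WithLp.toLp 2 fun bd' : PBond P 0 =>
        if h : bd' ∈ b then coordSU (w ⟨bd', h⟩) else (0 : lieSU (Fin 2))) : TangentBondSU P 0 2),
      hessOpAt (1 : ℝ) (1 : GaugeField P 0 (SU 2)) ((WithLp.toLp 2 fun bd' : PBond P 0 =>
        if h : bd' ∈ b then coordSU (w ⟨bd', h⟩) else (0 : lieSU (Fin 2))) : TangentBondSU P 0 2)⟫_ℝ with hQf_def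
  have hQc : Continuous Qf := continuous_flatQf (N := 2) b one_ne_zero
  have hQ0 : Qf 0 = 0 := by
    have h0 : (fun bd' : PBond P 0 => if h : bd' ∈ b then coordSU ((0 : BlockChartSU 2 b) ⟨bd', h⟩) else (0 : lieSU (Fin 2))) = 0 := by
      funext bd'
      split_ifs with h
      · rw [Pi.zero_apply, map_zero]; rfl
      · rfl
    simp only [hQf_def, h0, WithLp.toLp_zero, map_zero, inner_zero_right, mul_zero]
  -- measurability of the dressed presentation and of the statistic
  have hAm : Measurable fun z : BlockChartSU 2 b => (ball (0 : BlockChartSU 2 b) 1).indicator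
      (fun w => ENNReal.ofReal (Real.exp (-(1 / 2 * Qf w)))) z :=
    (ENNReal.measurable_ofReal.comp (Real.measurable_exp.comp (hQc.measurable.const_mul _).neg)).indicator measurableSet_ball
  have hUm : Measurable fun z : BlockChartSU 2 b => ‖z‖ := measurable_norm
  have hEnv : MeasurableSet {z : BlockChartSU 2 b | ‖z‖ < 100000000} := measurableSet_lt hUm measurable_const
  have hEnv' : MeasurableSet {z : BlockChartSU 2 b | ‖z‖ < 1000000000} := measurableSet_lt hUm measurable_const
  have hJ := neg_log_sinc_half_le
  refine ⟨P, 0, b, hb1, ?_, ?_⟩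
  · -- ROUTE 1: file 35's ★ (flat background; θ = 10⁸)
    refine cutChartLawAC_of_sect1Letters_analyticLocal_flat (N := 2) (lo := lo) (hi := hi) le_rfl b hb (S := 1 / 2) (by norm_num)
      (by linarith [Real.pi_gt_three]) (ball (0 : BlockChartSU 2 b) 1) (fun w => 1 / 2 * Qf w) (fun _ => 0) (fun _ => 0)
      hAm hUm MeasurableSet.univ hEnv (Env := {z : BlockChartSU 2 b | ‖z‖ < 100000000}) (σ := 0) (κ₀ := 1)
      (Q := 0) (L := 1) (B₃ := 1 / 100000000) (M₀ := 1) (A₀ := 1) (p₀g := 1) (Rk := 0) (WV := 0) (r := 3) (S₂ := 0) 1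
      (by norm_num) (by norm_num) (by norm_num) (by norm_num) one_pos le_rfl one_pos (by rw [hPd]; norm_num) le_rfl (by norm_num)
      (η := 1) one_ne_zero ?_ (convex_ball _ _) (mem_ball_self one_pos) ?_ hwrap hsides hbox hcomb
      0 (fun _ => (LinearMap.zero_apply _).symm) ?_ ?_ 0 ?_ (fun _ _ => differentiableOn_const _) ?_ ?_ ?_ ?_ ?_ ?_ ?_ ?_
    · -- hW
      norm_num
    · -- hexp: `A v = A 0 + ½·Qf v + 0 + 0`
      intro v _
      show 1 / 2 * Qf v = 1 / 2 * Qf 0 + 1 / 2 * Qf v + 0 + 0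
      rw [hQ0]; ring
    · -- h16 (1.6): `|0| < 3·10⁻⁸·…`
      intro v _
      unfold Ineq16
      norm_num
    · -- hV
      intro v _
      simp
    · -- hVt: `0 = Re 0`
      intro x _
      simp
    · -- hΦS: `‖0‖ ≤ 0`
      intro x _ u _
      simp
    · -- the convexity clause: `4·2·100³·0 ≤ 3²`
      rw [hPd]; norm_num
    · -- hUL: the norm is 1-Lipschitz
      intro a a'
      rw [one_mul]
      exact (le_abs_self _).trans (abs_norm_sub_norm_le a a')
    · -- hUc
      simp
    · -- the numeral's clause, with `W_J = 1·(2·2)·(−2 log sinc ½) ≤ 8/23`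
      rw [hb1, hd2, hPd]
      norm_num
      nlinarith [hJ]
    · -- henv: `‖l • z‖ = l‖z‖ < θ` for `l ∈ [l₀, 1]`
      intro l hl z _ h2 _
      rw [hb1] at hl
      have hl0 : 0 ≤ l := by
        have hx : (0 : ℝ) ≤ (1 : ℕ) * (dimSU 2 : ℝ) := by positivity
        have : 1 / (((1 : ℕ) : ℝ) * dimSU 2 + 1) ≤ 1 := by
          rw [div_le_one (by positivity)]
          linarith
        linarith [hl.1]
      show ‖l • z‖ < 100000000
      rw [norm_smul, Real.norm_of_nonneg hl0]
      calc l * ‖z‖ ≤ 1 * ‖z‖ := mul_le_mul_of_nonneg_right hl.2 (norm_nonneg _)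
        _ = ‖z‖ := one_mul _
        _ < 100000000 := h2
    · -- hRT: `‖s • z‖ = s‖z‖`
      intro z h1 _ _ s hs _ _ _
      rw [norm_smul, Real.norm_of_nonneg (by linarith : (0 : ℝ) ≤ s)]
      nlinarith [mul_le_mul_of_nonneg_left h1 (show (0 : ℝ) ≤ s - 1 by linarith)]
    · -- hQ: the envelope IS the sub-level event (Q = 0)
      have hempty : {z : BlockChartSU 2 b | ‖z‖ < 100000000} \ ({z : BlockChartSU 2 b | ‖z‖ < 100000000} ∩ univ) = ∅ := by
        ext z
        simp
      rw [hempty, measure_empty]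
      exact zero_le
  · -- ROUTE 2: file 34's ★ (the (1.7) row in torus letters at the flat member; θ = 10⁹)
    -- the matrix letter and the (1.7) row IN TORUS LETTERS at the flat quadratic member (file 35 §0, dag-n21-w3 g6's `ineq17_flat_liftSU`)
    obtain ⟨Mq, hQf⟩ := exists_matrix_flatQf (N := 2) (P := P) (j := 0) b one_ne_zero
    have hSp : (boxPlaqs lo hi : Set (Plaq P 0)) ⊆ ↑(Finset.univ : Finset (Plaq P 0)) := by
      rw [Finset.coe_univ]; exact Set.subset_univ _
    refine cutChartLawAC_of_sect1Letters_analyticLocal_of_ineq17_torus (N := 2) (lo := lo) (hi := hi) le_rfl b hb (S := 1 / 2) (by norm_num)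
      (by linarith [Real.pi_gt_three]) (ball (0 : BlockChartSU 2 b) 1) (fun w => 1 / 2 * Qf w) Qf (fun _ => 0) (fun _ => 0)
      hAm hUm MeasurableSet.univ hEnv' (Env := {z : BlockChartSU 2 b | ‖z‖ < 1000000000}) (σ := 0) (κ₀ := 1)
      (Q := 0) (L := 1) (γ₀ := 1) (B₃ := 1 / 1000000000) (M₀ := 1) (A₀ := 1) (p₀g := 1) (Rk := 0) (WV := 0) (r := 3) (S₂ := 0)
      (Cc := 0) (εk := 0) 1
      (by norm_num) (by norm_num) (by norm_num) (by norm_num) one_pos le_rfl one_pos (by rw [hPd]; norm_num) le_rfl one_pos (by norm_num)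
      ?_ (convex_ball _ _) (mem_ball_self one_pos) ?_ Mq hQf hwrap hsides hbox hcomb Finset.univ hSp
      (fun v => ineq17_flat_liftSU (N := 2) (b := b) one_ne_zero ((1 : ℕ) : ℝ) 0 0 v) ?_
      0 (fun _ => (LinearMap.zero_apply _).symm) ?_ ?_ 0 ?_ (fun _ _ => differentiableOn_const _) ?_ ?_ ?_ ?_ ?_ ?_ ?_ ?_
    · -- hW
      norm_num
    · -- hexp: `A v = A 0 + ½·Qf v + 0 + 0`
      intro v _
      show 1 / 2 * Qf v = 1 / 2 * Qf 0 + 1 / 2 * Qf v + 0 + 0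
      rw [hQ0]; ring
    · -- hsmall: the (1.7) row's correction is `0` at the flat background
      rw [zero_mul, hPd]
      positivity
    · -- h16 (1.6): `|0| < 3·10⁻⁸·…`
      intro v _
      unfold Ineq16
      norm_num
    · -- hV
      intro v _
      simp
    · -- hVt: `0 = Re 0`
      intro x _
      simp
    · -- hΦS: `‖0‖ ≤ 0`
      intro x _ u _
      simp
    · -- the convexity clause: `4·2·100³·0 ≤ 1·3²`
      rw [hPd]; norm_num
    · -- hUL: the norm is 1-Lipschitz
      intro a a'
      rw [one_mul]
      exact (le_abs_self _).trans (abs_norm_sub_norm_le a a')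
    · -- hUc
      simp
    · -- the numeral's clause, with `W_J = 1·(2·2)·(−2 log sinc ½) ≤ 8/23`
      rw [hb1, hd2, hPd]
      norm_num
      nlinarith [hJ]
    · -- henv: `‖l • z‖ = l‖z‖ < θ` for `l ∈ [l₀, 1]`
      intro l hl z _ h2 _
      rw [hb1] at hl
      have hl0 : 0 ≤ l := by
        have hx : (0 : ℝ) ≤ (1 : ℕ) * (dimSU 2 : ℝ) := by positivity
        have : 1 / (((1 : ℕ) : ℝ) * dimSU 2 + 1) ≤ 1 := by
          rw [div_le_one (by positivity)]
          linarith
        linarith [hl.1]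
      show ‖l • z‖ < 1000000000
      rw [norm_smul, Real.norm_of_nonneg hl0]
      calc l * ‖z‖ ≤ 1 * ‖z‖ := mul_le_mul_of_nonneg_right hl.2 (norm_nonneg _)
        _ = ‖z‖ := one_mul _
        _ < 1000000000 := h2
    · -- hRT: `‖s • z‖ = s‖z‖`
      intro z h1 _ _ s hs _ _ _
      rw [norm_smul, Real.norm_of_nonneg (by linarith : (0 : ℝ) ≤ s)]
      nlinarith [mul_le_mul_of_nonneg_left h1 (show (0 : ℝ) ≤ s - 1 by linarith)]
    · -- hQ: the envelope IS the sub-level event (Q = 0)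
      have hempty : {z : BlockChartSU 2 b | ‖z‖ < 1000000000} \ ({z : BlockChartSU 2 b | ‖z‖ < 1000000000} ∩ univ) = ∅ := by
        ext z
        simp
      rw [hempty, measure_empty]
      exact zero_le

end Witness

end Summit.QuantumFields.YangMills.Theorems.N21LowCentreEndAtSUNBlockChartPackageCoerciveFlatWitness

end
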